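/-
Origin: expansion seat `planner-pub-hodgecm-pv09-g7-0`, handover #3 13:33:25Z (md5 59fddeeb4161d52b6365e6105e7e2f69; NEW additive leaf; TWO import rewrites by the generic ^import Pv[0-9]+g[0-9]+\. -> import HodgeCM.PerL34. rule: Pv07g5.GenuineCoeffInput (pv07-g5 RUN-30 #3 3185ada8), Pv09g6.GenuineTensorInput (RUN 29 row d7518b51, installed); land AFTER HodgeCM/PerL34/GenuineCoeffInput.lean; HOLD iff that row is held; independent of my #1/#2) (`HOME/pub-hodgecm-pv09-g7/lean/Pv09g7/GenuineCoeffMatch.lean`, md5 59fddeeb, 424 lines);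
landed by the gen-8 packager in gate run 30 as `HodgeCM/PerL34/GenuineCoeffMatch.lean` (import ^import Pv07g5\.GenuineCoeffInput[ \t]*$→import HodgeCM.PerL34.GenuineCoeffInput ×1; import ^import Pv09g6\.GenuineTensorInput[ \t]*$→import HodgeCM.PerL34.GenuineTensorInput ×1).
-/
/-
Copyright: HodgeCM publication cell (pub-hodgecm), seam S3 (𝓕-side / genuine idelic torus end; the S3 END
for a doubling datum on ANY inner-product space whose distinguished vector has the `⊗′`-model's diagonal matrix
coefficient).  Prover seat pub-hodgecm-pv09-g7 (DAG-node prover #09, generation 7), file #3; intended final place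
`HodgeCM/PerL34/GenuineCoeffMatch.lean`.
WIP imports: `Pv07g5.GenuineCoeffInput` ↦ `HodgeCM.PerL34.GenuineCoeffInput` (pv07-g5 #3, RUN 30, 3185ada8),
`Pv09g6.GenuineTensorInput` ↦ `HodgeCM.PerL34.GenuineTensorInput` (pv09-g6 #3, RUN 29).  Complete proofs, no new
axioms, nothing cited.  Released under the package licence.
-/
import Summits.HodgeConjecture.HodgeCM.PerL34.GenuineCoeffInput_2
import Summits.HodgeConjecture.HodgeCM.PerL34.GenuineTensorInput

/-!
# The S3 END by coefficient matching: one scalar identity on the datum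

The S3 END (pv09-g4 `exists_compactDomain_thetaLift_ne_zero_of_model`, fed through pv09-g5/g6 and pv07-g5) reads
the TORUS side of Lemma 4.2(b) only through the diagonal matrix coefficient `g ↦ ⟪φ, ω(g)φ⟫` of ONE vector: every
field of pv07-g5's coefficient-level input `GenuineCoeffInput L S Sp ω φ χ` (#3) — the unramified identities
`hcoeffU`, the ramified ones `hcoeffS`, and (by the equality case of Cauchy–Schwarz) the isotypy `hiso` — and the
three END binders `‖φ‖ = 1`, `hK` (the level fixes `φ`), `hM` (multiplicativity over finite sets of places) are
functions of that one scalar function on `Model L = T(𝔸_{L⁺,f}) × T_∞`.  Hence they TRANSPORT along an equality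
of coefficient functions, with no map between the spaces at all:

* §1 `CoeffMatch.eq_of_inner_eq_one`, `norm_eq_of_coeffEq`, `fixed_of_coeffEq`, `smul_eq_of_coeffEq`,
  `prodFormula_of_coeffEq` — two pairs `(ω₁, φ₁)`, `(ω₂, φ₂)` on different spaces with
  `∀ g, ⟪φ₁, ω₁ g φ₁⟫ = ⟪φ₂, ω₂ g φ₂⟫` have the same norm, the same fixed / isotypic group elements (when
  `‖φ₂‖ = 1`) and the same product formulae;
* §2 **`CoeffMatch.coeffInputOfEq`** `: GenuineCoeffInput L S Sp₂ ω₂ φ₂ χ → ‖φ₂‖ = 1 →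
  (∀ g, ⟪φ₁, ω₁ g φ₁⟫ = ⟪φ₂, ω₂ g φ₂⟫) → GenuineCoeffInput L S Sp₁ ω₁ φ₁ χ` — the map-free companion of
  pv07-g5's `GenuineCoeffInput.map / comap`;
* §3 **`exists_compactDomain_thetaLift_ne_zero_genuine_of_coeffMatch`** — pv07-g5's
  `…_genuine_of_coeffInput` for a datum `D` on ANY inner-product space `Sp` (complete or not) and `φ ∈ Sp`, with
  the torus side supplied by ANY model `(Sp₂, ω₂, φ₂)` carrying it at coefficient level plus the one identity
  `hcoeff : ∀ g, ⟪φ, D.ω g φ⟫ = ⟪φ₂, ω₂ g φ₂⟫`; conclusion for `φ` itself;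
* §4 **`Genuine.exists_compactDomain_thetaLift_ne_zero_genuine_tensor_of_coeffMatch`** — the model taken to be
  the genuine `⊗′`-model of pv09-g6 (`⊗′_v (H_v, e_v)`, `⊗′ρ_v`, `φ• = ⊗ φ•_v`; its coefficient-level input is
  pv09-g6 #3 `thetaInputOfData` through pv07-g5 `GenuineThetaInput.toCoeffInput`): for EVERY CM field `L`,
  `S ⊇ T' ∪ {∞}`, `χ`, free local data `ν`, centres `x₀`, ANY doubling datum `D` on ANY inner-product space and
  ANY `φ ∈ Sp` with `⟪φ, D.ω g φ⟫ = ⟪φ•, ⊗′ρ(g) φ•⟫` for all `g`: the END's conclusion for `φ`;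
  **`…_of_eulerProduct`** — the same hypothesis written as the EULER PRODUCT
  `⟪φ, D.ω g φ⟫ = ∏ᶠ_v ⟪φ•_v, ρ_v(g_v) φ•_v⟫` (pv09-g6 `inner_tp_rep_tp`), i.e. PerL v5 ll. 600–616
  ("`φ = ⊗φ_v` … `⟨ω(y)φ, φ⟩ = ∏_v ⟨ω_v(y_v)φ_v, φ_v⟩`") taken AS the hypothesis on the datum — the weakest
  representation-side interface of the seam: no model equality (pv09-g6 #4), no embedding (pv07-g5 #2/#4/#5),
  no kernel map (this seat's #2), no completeness;
* §5 `…_of_kernelMap'` — consistency: this seat's #2 `…_of_kernelMap` re-derived WITHOUT `[CompleteSpace Sp]`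
  (a kernel map gives the identity by `inner_tp_tp` / `rep_tp`), so the universal-property route of #1/#2 and the
  coefficient route agree and the latter is the more general.

Honest limits: exactly as in #2 — the ambient binders (`D`, `GU`, `j, hj`, `P`, `hχVΓ`, `hloc` on `Sp`, finiteness
of `GU.μ`) and the character-side ones (`hχΓ, hχT', hlocχ`) remain; producing the datum (PerL's adelic theta
MODEL, GAPS carverg2-X1) and verifying the coefficient identity for it (the local computations of L4.1 on the
genuine Schrödinger model) are not done here; nothing is cited; no PRINT item is touched.
-/

set_option autoImplicit false

noncomputable section

open MeasureTheory MeasureTheory.Measure Set Metric Function Complex ComplexConjugate Topology Filter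
open scoped RestrictedProduct InnerProductSpace NNReal ENNReal

/-! ## §1  Two pairs `(ω, φ)` with the same diagonal matrix coefficient -/

namespace HodgeCM.PerL34.PureTensor.CoeffMatch

section generic

variable {F : Type*} [NormedAddCommGroup F] [InnerProductSpace ℂ F]

/-- Equality case of Cauchy–Schwarz for unit vectors: `⟪u, v⟫ = 1 ⟹ u = v`. -/
theorem eq_of_inner_eq_one {u v : F} (hu : ‖u‖ = 1) (hv : ‖v‖ = 1) (h : ⟪u, v⟫_ℂ = 1) : u = v := by
  have h' := (inner_eq_norm_mul_iff (𝕜 := ℂ) (x := u) (y := v)).1 (by rw [h, hu, hv]; simp)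
  simpa [hu, hv] using h'

variable {Γ : Type*} [Group Γ]
  {Sp₁ Sp₂ : Type*} [NormedAddCommGroup Sp₁] [InnerProductSpace ℂ Sp₁]
  [NormedAddCommGroup Sp₂] [InnerProductSpace ℂ Sp₂]
  (ω₁ : Γ →* (Sp₁ ≃ₗᵢ[ℂ] Sp₁)) (ω₂ : Γ →* (Sp₂ ≃ₗᵢ[ℂ] Sp₂)) {φ₁ : Sp₁} {φ₂ : Sp₂}
  (h : ∀ g : Γ, ⟪φ₁, ω₁ g φ₁⟫_ℂ = ⟪φ₂, ω₂ g φ₂⟫_ℂ)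

include h

/-- same coefficient function ⟹ same norm (`g := 1`). -/
theorem norm_eq_of_coeffEq : ‖φ₁‖ = ‖φ₂‖ := by
  have h1 := h 1
  simp only [map_one, LinearIsometryEquiv.coe_one, id_eq] at h1
  rw [inner_self_eq_norm_sq_to_K, inner_self_eq_norm_sq_to_K] at h1
  have h2 : ‖φ₁‖ ^ 2 = ‖φ₂‖ ^ 2 := by exact_mod_cast h1
  exact (pow_left_inj₀ (norm_nonneg _) (norm_nonneg _) two_ne_zero).1 h2

/-- (Ported verbatim from the HodgeCMPerL package; no docstring in the source.) -/
theorem norm_eq_one_of_coeffEq (hφ₂ : ‖φ₂‖ = 1) : ‖φ₁‖ = 1 := (norm_eq_of_coeffEq ω₁ ω₂ h).trans hφ₂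

/-- isotypy transports: `ω₂ g φ₂ = c • φ₂` with `‖c‖ = 1` ⟹ `ω₁ g φ₁ = c • φ₁`. -/
theorem smul_eq_of_coeffEq (hφ₂ : ‖φ₂‖ = 1) {g : Γ} {c : ℂ} (hc : ‖c‖ = 1) (hg : ω₂ g φ₂ = c • φ₂) :
    ω₁ g φ₁ = c • φ₁ := by
  have h1 : ‖φ₁‖ = 1 := norm_eq_one_of_coeffEq ω₁ ω₂ h hφ₂
  refine (eq_of_inner_eq_one (by rw [norm_smul, hc, h1, one_mul])
    (by rw [LinearIsometryEquiv.norm_map, h1]) ?_).symm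
  rw [inner_smul_left, h g, hg, inner_smul_right, inner_self_eq_norm_sq_to_K, hφ₂, ← mul_assoc,
    ← Complex.normSq_eq_conj_mul_self, Complex.normSq_eq_norm_sq, hc]
  simp

/-- fixed vectors transport: `ω₂ k φ₂ = φ₂ ⟹ ω₁ k φ₁ = φ₁`. -/
theorem fixed_of_coeffEq (hφ₂ : ‖φ₂‖ = 1) {k : Γ} (hk : ω₂ k φ₂ = φ₂) : ω₁ k φ₁ = φ₁ := by
  simpa using smul_eq_of_coeffEq ω₁ ω₂ h hφ₂ (c := 1) (by simp) (by simpa using hk)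

/-- (Ported verbatim from the HodgeCMPerL package; no docstring in the source.) -/
theorem fixed_of_mem_of_coeffEq (hφ₂ : ‖φ₂‖ = 1) {K : Set Γ} (hK : ∀ k ∈ K, ω₂ k φ₂ = φ₂) :
    ∀ k ∈ K, ω₁ k φ₁ = φ₁ :=
  fun _ hk => fixed_of_coeffEq ω₁ ω₂ h hφ₂ (hK _ hk)

end generic

section restricted

variable {ι : Type*} {G : ι → Type*} [∀ i, Group (G i)] [DecidableEq ι]
  {Sub : ι → Type*} [∀ i, SetLike (Sub i) (G i)] [∀ i, SubgroupClass (Sub i) (G i)] (B : ∀ i, Sub i)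
  {Sp₁ Sp₂ : Type*} [NormedAddCommGroup Sp₁] [InnerProductSpace ℂ Sp₁]
  [NormedAddCommGroup Sp₂] [InnerProductSpace ℂ Sp₂]
  (ω₁ : (Πʳ i, [G i, B i]) →* (Sp₁ ≃ₗᵢ[ℂ] Sp₁)) (ω₂ : (Πʳ i, [G i, B i]) →* (Sp₂ ≃ₗᵢ[ℂ] Sp₂))
  {φ₁ : Sp₁} {φ₂ : Sp₂} (h : ∀ g, ⟪φ₁, ω₁ g φ₁⟫_ℂ = ⟪φ₂, ω₂ g φ₂⟫_ℂ)

include h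

/-- the local coefficients agree. -/
theorem localCoeff_eq_of_coeffEq (i : ι) (g : G i) : localCoeff B ω₁ φ₁ i g = localCoeff B ω₂ φ₂ i g := h _

/-- product formulae transport. -/
theorem prodFormula_of_coeffEq {T : Finset ι}
    (hM : ∀ S : Finset ι, T ⊆ S → ∀ y : (i : ↥S) → G i,
      ⟪φ₂, ω₂ (extendOne B S y) φ₂⟫_ℂ = ∏ i : ↥S, localCoeff B ω₂ φ₂ i (y i)) :
    ∀ S : Finset ι, T ⊆ S → ∀ y : (i : ↥S) → G i,
      ⟪φ₁, ω₁ (extendOne B S y) φ₁⟫_ℂ = ∏ i : ↥S, localCoeff B ω₁ φ₁ i (y i) := by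
  intro S hS y
  rw [h, hM S hS y]
  exact Finset.prod_congr rfl fun i _ => (localCoeff_eq_of_coeffEq B ω₁ ω₂ h i (y i)).symm

end restricted

end HodgeCM.PerL34.PureTensor.CoeffMatch

/-! ## §2  The coefficient-level input transports along an equality of coefficient functions -/

namespace HodgeCM.PerL34.PureTensor

open HodgeCM.PerL34.SplitShells HodgeCM.PerL34.AdelicFactorisation HodgeCM.PerL34.RestrictedMeasure
open HodgeCM.PerL34.NoSmallSubgroups HodgeCM.PerL34.EulerFactorisation HodgeCM.PerL34.DiscreteFD
open HodgeCM.PerL34.LocalFactors HodgeCM.PerL34.LocalFactors.DilationModel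
open HodgeCM.PerL34.LocalModulus HodgeCM.PerL34.SplitPlaceDilation
open HodgeCM.PerL34.RallisIP HodgeCM.PerL34.Doubling HodgeCM.PerL34.N31d NumberField IsDedekindDomain
open HodgeCM.PerL34.IdelePlaces HodgeCM.PerL34.RestrictedRegroup HodgeCM.PerL34.RestrictedCutout
open HodgeCM.PerL34.IdelicTorusModel HodgeCM.PerL34.IdelicTorusModel.Genuine

attribute [local instance] LocalFactors.DilationModel.Adic.nontriviallyNormedField
  LocalFactors.DilationModel.Adic.properSpace

namespace CoeffMatch

variable {L : Type} [Field L] [NumberField L] [IsCMField L]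
  [DecidableEq (Place (maximalRealSubfield L))]
  [∀ v : HeightOneSpectrum (𝓞 (maximalRealSubfield L)), MeasurableSpace (v.adicCompletion (maximalRealSubfield L))]
  [∀ v : HeightOneSpectrum (𝓞 (maximalRealSubfield L)), BorelSpace (v.adicCompletion (maximalRealSubfield L))]
  {S : Finset (Place (maximalRealSubfield L))}
  {Sp₁ Sp₂ : Type} [NormedAddCommGroup Sp₁] [InnerProductSpace ℂ Sp₁]
  [NormedAddCommGroup Sp₂] [InnerProductSpace ℂ Sp₂]
  {ω₁ : Model L →* (Sp₁ ≃ₗᵢ[ℂ] Sp₁)} {ω₂ : Model L →* (Sp₂ ≃ₗᵢ[ℂ] Sp₂)}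
  {φ₁ : Sp₁} {φ₂ : Sp₂} {χ : Model L →* Circle}

/-- **coefficient-level input by coefficient matching.**  If `(Sp₂, ω₂, φ₂)` carries pv07-g5's coefficient-level
torus-side input, `‖φ₂‖ = 1`, and `(Sp₁, ω₁, φ₁)` has the SAME diagonal coefficient
`⟪φ₁, ω₁ g φ₁⟫ = ⟪φ₂, ω₂ g φ₂⟫` for every `g ∈ Model L`, then `(Sp₁, ω₁, φ₁)` carries the input too — with the
same data `ν, x₀, r, c`.  No map `Sp₁ → Sp₂` or `Sp₂ → Sp₁` is asked for. -/
def coeffInputOfEq (X : GenuineCoeffInput L S Sp₂ ω₂ φ₂ χ) (hφ₂ : ‖φ₂‖ = 1)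
    (h : ∀ g : Model L, ⟪φ₁, ω₁ g φ₁⟫_ℂ = ⟪φ₂, ω₂ g φ₂⟫_ℂ) : GenuineCoeffInput L S Sp₁ ω₁ φ₁ χ where
  ν := X.ν
  hν := X.hν
  hcoeffU i hi hs g := by
    rw [localCoeff_eq_of_coeffEq (genLevel L) ω₁ ω₂ h]
    exact X.hcoeffU i hi hs g
  x₀ := X.x₀
  r := X.r
  c := X.c
  hr := X.hr
  hr0 := X.hr0
  hc := X.hc
  hνS := X.hνS
  hχS := X.hχS
  hcoeffS i hi hs g := by
    rw [localCoeff_eq_of_coeffEq (genLevel L) ω₁ ω₂ h]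
    exact X.hcoeffS i hi hs g
  hiso i hi hs g := smul_eq_of_coeffEq ω₁ ω₂ h hφ₂
    (by rw [RCLike.norm_conj, Circle.norm_coe]) (X.hiso i hi hs g)

/-- (Ported verbatim from the HodgeCMPerL package; no docstring in the source.) -/
@[simp] theorem coeffInputOfEq_ν (X : GenuineCoeffInput L S Sp₂ ω₂ φ₂ χ) (hφ₂ : ‖φ₂‖ = 1)
    (h : ∀ g : Model L, ⟪φ₁, ω₁ g φ₁⟫_ℂ = ⟪φ₂, ω₂ g φ₂⟫_ℂ) : (coeffInputOfEq X hφ₂ h).ν = X.ν := rfl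

/-- (Ported verbatim from the HodgeCMPerL package; no docstring in the source.) -/
@[simp] theorem coeffInputOfEq_c (X : GenuineCoeffInput L S Sp₂ ω₂ φ₂ χ) (hφ₂ : ‖φ₂‖ = 1)
    (h : ∀ g : Model L, ⟪φ₁, ω₁ g φ₁⟫_ℂ = ⟪φ₂, ω₂ g φ₂⟫_ℂ) : (coeffInputOfEq X hφ₂ h).c = X.c := rfl

end CoeffMatch

/-! ## §3  The END for a datum on any inner-product space, torus side by coefficient matching with a model -/

section coeffMatch

variable (L : Type) [Field L] [NumberField L] [IsCMField L]

variable [DecidableEq (Place (maximalRealSubfield L))]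
  [∀ v : HeightOneSpectrum (𝓞 (maximalRealSubfield L)), MeasurableSpace (v.adicCompletion (maximalRealSubfield L))]
  [∀ v : HeightOneSpectrum (𝓞 (maximalRealSubfield L)), BorelSpace (v.adicCompletion (maximalRealSubfield L))]
  (S₀ : Finset (Place (maximalRealSubfield L)))
  {Sp : Type} [NormedAddCommGroup Sp] [InnerProductSpace ℂ Sp]
  {W : Type} [AddCommGroup W] [Module L W]
  {H Sbox : Type} [Group H] [AddCommGroup Sbox] [Module ℂ Sbox]
  {h : W →ₗ⋆[L] W →ₗ[L] L} (hW : IsLine L W) (hh : Anisotropic h)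
  (D : DoublingDatum (Model L) H Sp Sbox) (GU : ThetaSide Sp Sbox)
  (j : isomBox h →* H) (hj : ∀ d : unitary L, j ⟨iotaSnd d, iotaSnd_mem h d⟩ = D.ι (1, unitaryToModel L d))
  (χ : Model L →* Circle) (hχΓ : ∀ d : unitary L, χ (unitaryToModel L d) = 1)
  (hχVΓ : ∀ d : unitary L, D.χV (unitaryToModel L d) = 1)
  {hP : ∀ Ψ : Sbox, ∀ p ∈ (stabDelta L W).subgroupOf (isomBox h), ∀ x : H,
    D.fSW Ψ (j p * x) = D.fSW Ψ x}
  (P : GluePrintInputs D GU h j hP)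
  (hloc : ∀ (i : Place (maximalRealSubfield L)) (v : Sp),
    Continuous fun g : locTorus (maximalRealSubfield L) L i => D.ω (RestrictedProduct.mulSingle (genLevel L) i g) v)
  {T' : Finset (Place (maximalRealSubfield L))} (hχT' : RestrictedProduct.boxSubgroup (genLevel L) T' ≤ χ.ker)
  (hlocχ : ∀ i ∈ T', Continuous fun g : locTorus (maximalRealSubfield L) L i => χ (RestrictedProduct.mulSingle (genLevel L) i g))
  -- the MODEL `(Sp₂, ω₂, φ₂)` with its torus side at coefficient level
  {Sp₂ : Type} [NormedAddCommGroup Sp₂] [InnerProductSpace ℂ Sp₂]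
  (ω₂ : Model L →* (Sp₂ ≃ₗᵢ[ℂ] Sp₂)) (φ₂ : Sp₂) (hφ₂ : ‖φ₂‖ = 1)
  {T : Finset (Place (maximalRealSubfield L))} (hK₂ : ∀ k ∈ RestrictedProduct.boxSubgroup (genLevel L) T, ω₂ k φ₂ = φ₂)
  (hM₂ : ∀ S : Finset (Place (maximalRealSubfield L)), T ⊆ S → ∀ y : (i : ↥S) → locTorus (maximalRealSubfield L) L i,
    inner ℂ φ₂ (ω₂ (extendOne (genLevel L) S y) φ₂) = ∏ i : ↥S, localCoeff (genLevel L) ω₂ φ₂ i (y i))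
  {S : Finset (Place (maximalRealSubfield L))} (hTS : T ⊆ S) (hT'S : T' ⊆ S)
  (hS : ∀ v : InfinitePlace (maximalRealSubfield L), Sum.inl v ∈ S)
  (X₂ : GenuineCoeffInput L S Sp₂ ω₂ φ₂ χ)
  -- the datum's vector and the ONE identity
  (φ : Sp) (hcoeff : ∀ g : Model L, ⟪φ, D.ω g φ⟫_ℂ = ⟪φ₂, ω₂ g φ₂⟫_ℂ)

include hW hh hj hχΓ hχVΓ P hloc hφ₂ hK₂ hM₂ hTS hT'S hS X₂ hcoeff

set_option synthInstance.maxHeartbeats 200000 in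
-- (as in pv09-g5 / pv07-g5: the `SMul Γ (Model L)` instance behind `IsFundamentalDomain` is slow to find)
/-- **S3 END BY COEFFICIENT MATCHING.**  pv07-g5's `exists_compactDomain_thetaLift_ne_zero_genuine_of_coeffInput`
for the datum's own `(Sp, D.ω, φ)`, every torus-side binder (`‖φ‖ = 1`, `hK`, `hM`, the coefficient-level input)
TRANSPORTED from a model `(Sp₂, ω₂, φ₂)` along the single identity `hcoeff : ⟪φ, D.ω g φ⟫ = ⟪φ₂, ω₂ g φ₂⟫`.
`Sp` is any inner-product space; no map between `Sp₂` and `Sp` occurs. -/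
theorem exists_compactDomain_thetaLift_ne_zero_genuine_of_coeffMatch [IsFiniteMeasure GU.μ] :
    ∃ 𝓕 : Set (Model L), IsCompact 𝓕 ∧ (interior 𝓕).Nonempty ∧ MeasurableSet 𝓕 ∧
      IsFundamentalDomain (unitaryToModel L).range 𝓕 (haarDatum (genLevel L) (isCompact_genLevel L) (isOpen_genLevel L) S₀).μ ∧
      (haarDatum (genLevel L) (isCompact_genLevel L) (isOpen_genLevel L) S₀).μ 𝓕 ≠ 0 ∧
      (haarDatum (genLevel L) (isCompact_genLevel L) (isOpen_genLevel L) S₀).μ 𝓕 ≠ ⊤ ∧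
      ∀ [IsFiniteMeasure (((haarDatum (genLevel L) (isCompact_genLevel L) (isOpen_genLevel L) S₀).μ).restrict 𝓕)]
        (hk : Measurable (Function.uncurry (thetaFn D GU φ))) {Ck : ℝ} (hCk : 0 ≤ Ck)
        (hkC : ∀ q u, ‖thetaFn D GU φ q u‖ ≤ Ck),
        PeterssonFubini.theta GU.μ (((haarDatum (genLevel L) (isCompact_genLevel L) (isOpen_genLevel L) S₀).μ).restrict 𝓕) hk
          (measurable_coe_char (genLevel L) (isOpen_genLevel L) χ hχT' hlocχ) hCk hkC (norm_coe_char_le χ) ≠ 0 :=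
  exists_compactDomain_thetaLift_ne_zero_genuine_of_coeffInput L S₀ hW hh D GU j hj χ hχΓ hχVΓ P hloc hχT' hlocχ φ
    (CoeffMatch.norm_eq_one_of_coeffEq D.ω ω₂ hcoeff hφ₂)
    (CoeffMatch.fixed_of_mem_of_coeffEq D.ω ω₂ hcoeff hφ₂ hK₂)
    (CoeffMatch.prodFormula_of_coeffEq (genLevel L) D.ω ω₂ hcoeff hM₂) hTS hT'S hS
    (CoeffMatch.coeffInputOfEq X₂ hφ₂ hcoeff)

end coeffMatch

end HodgeCM.PerL34.PureTensor

/-! ## §4  The model := the genuine `⊗′`-model of pv09-g6 -/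

namespace HodgeCM.PerL34.RestrictedTensor.Genuine

open HodgeCM.PerL34.SplitShells HodgeCM.PerL34.AdelicFactorisation HodgeCM.PerL34.RestrictedMeasure
open HodgeCM.PerL34.NoSmallSubgroups HodgeCM.PerL34.EulerFactorisation HodgeCM.PerL34.DiscreteFD
open HodgeCM.PerL34.LocalFactors HodgeCM.PerL34.LocalFactors.DilationModel
open HodgeCM.PerL34.LocalModulus HodgeCM.PerL34.SplitPlaceDilation
open HodgeCM.PerL34.RallisIP HodgeCM.PerL34.Doubling HodgeCM.PerL34.N31d NumberField IsDedekindDomain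
open HodgeCM.PerL34.IdelePlaces HodgeCM.PerL34.RestrictedRegroup HodgeCM.PerL34.RestrictedCutout
open HodgeCM.PerL34.IdelicTorusModel HodgeCM.PerL34.IdelicTorusModel.Genuine HodgeCM.PerL34.PureTensor

attribute [local instance] LocalFactors.DilationModel.Adic.nontriviallyNormedField
  LocalFactors.DilationModel.Adic.properSpace

variable (L : Type) [Field L] [NumberField L] [IsCMField L]

section tensor

variable [DecidableEq (Place (maximalRealSubfield L))]
  [∀ v : HeightOneSpectrum (𝓞 (maximalRealSubfield L)), MeasurableSpace (v.adicCompletion (maximalRealSubfield L))]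
  [∀ v : HeightOneSpectrum (𝓞 (maximalRealSubfield L)), BorelSpace (v.adicCompletion (maximalRealSubfield L))]
  (S₀ : Finset (Place (maximalRealSubfield L)))
  {Sp : Type} [NormedAddCommGroup Sp] [InnerProductSpace ℂ Sp]
  {W : Type} [AddCommGroup W] [Module L W]
  {H Sbox : Type} [Group H] [AddCommGroup Sbox] [Module ℂ Sbox]
  {h : W →ₗ⋆[L] W →ₗ[L] L} (hW : IsLine L W) (hh : Anisotropic h)
  (D : DoublingDatum (Model L) H Sp Sbox) (GU : ThetaSide Sp Sbox)
  (j : isomBox h →* H) (hj : ∀ d : unitary L, j ⟨iotaSnd d, iotaSnd_mem h d⟩ = D.ι (1, unitaryToModel L d))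
  (χ : Model L →* Circle) (hχΓ : ∀ d : unitary L, χ (unitaryToModel L d) = 1)
  (hχVΓ : ∀ d : unitary L, D.χV (unitaryToModel L d) = 1)
  {hP : ∀ Ψ : Sbox, ∀ p ∈ (stabDelta L W).subgroupOf (isomBox h), ∀ x : H, D.fSW Ψ (j p * x) = D.fSW Ψ x}
  (P : GluePrintInputs D GU h j hP)
  (hloc : ∀ (i : Place (maximalRealSubfield L)) (v : Sp),
    Continuous fun g : locTorus (maximalRealSubfield L) L i => D.ω (RestrictedProduct.mulSingle (genLevel L) i g) v)
  {T' : Finset (Place (maximalRealSubfield L))}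
  (hχT' : RestrictedProduct.boxSubgroup (genLevel L) T' ≤ χ.ker)
  (hlocχ : ∀ i ∈ T', Continuous fun g : locTorus (maximalRealSubfield L) L i =>
    χ (RestrictedProduct.mulSingle (genLevel L) i g))
  {S : Finset (Place (maximalRealSubfield L))} (hT'S : T' ⊆ S)
  (hS : ∀ v : InfinitePlace (maximalRealSubfield L), Sum.inl v ∈ S)
  {ν : ∀ i : Place (maximalRealSubfield L),
    ((basePlaceOf L i).adicCompletion (maximalRealSubfield L))ˣ →* Circle}
  (hν : ∀ i, i ∉ S → IsSplitPlace L i →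
    ∀ u : ((basePlaceOf L i).adicCompletion (maximalRealSubfield L))ˣ,
      ‖(u : (basePlaceOf L i).adicCompletion (maximalRealSubfield L))‖ = 1 → ν i u = 1)
  (hνc : ∀ i, IsSplitPlace L i → Continuous (ν i))
  (x₀ : ∀ i : Place (maximalRealSubfield L), Fin 3 → (basePlaceOf L i).adicCompletion (maximalRealSubfield L))
  (hx₀ : ∀ i ∈ S, IsSplitPlace L i → x₀ i ≠ 0)
  (φ : Sp)

include hW hh hj hχΓ hχVΓ P hloc hT'S hS hν

set_option synthInstance.maxHeartbeats 200000 in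
/-- **S3 END for ANY datum, torus side by coefficient matching with the genuine `⊗′`-model.**  For every CM field
`L`, finite `S ⊇ T' ∪ {∞}`, character `χ` (level `K_{T'}`, local continuity on `T'`, trivial on `U(1)(L⁺)`), free
local data `ν` (unramified at the split places off `S`, continuous at the split places), centres `x₀ ≠ 0` at the
split places of `S`, ANY doubling datum `D` on ANY inner-product space `Sp` (strongly continuous on the local
groups, `hloc`) and ANY `φ ∈ Sp` whose diagonal matrix coefficient is the `⊗′`-model's,
`hcoeff : ∀ g, ⟪φ, D.ω g φ⟫ = ⟪φ•, ⊗′ρ(g) φ•⟫` (`φ• = phi L S x₀ (radius …)`, `⊗′ρ = rep (admissible L hν hχT')`):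
the END's conclusion for `φ`.  The model side is pv09-g6 #2/#3 (`norm_phi`, `rep_phi_eq_self`,
`inner_phi_rep_extendOne`, `thetaInputOfData`) through pv07-g5 `GenuineThetaInput.toCoeffInput`. -/
theorem exists_compactDomain_thetaLift_ne_zero_genuine_tensor_of_coeffMatch
    (hcoeff : ∀ g : Model L, ⟪φ, D.ω g φ⟫_ℂ =
      ⟪phi L S x₀ (radius L S hνc hχT' hlocχ x₀ hx₀),
        rep (admissible L hν hχT') g (phi L S x₀ (radius L S hνc hχT' hlocχ x₀ hx₀))⟫_ℂ)
    [IsFiniteMeasure GU.μ] :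
    ∃ 𝓕 : Set (Model L), IsCompact 𝓕 ∧ (interior 𝓕).Nonempty ∧ MeasurableSet 𝓕 ∧
      IsFundamentalDomain (unitaryToModel L).range 𝓕
        (haarDatum (genLevel L) (isCompact_genLevel L) (isOpen_genLevel L) S₀).μ ∧
      (haarDatum (genLevel L) (isCompact_genLevel L) (isOpen_genLevel L) S₀).μ 𝓕 ≠ 0 ∧
      (haarDatum (genLevel L) (isCompact_genLevel L) (isOpen_genLevel L) S₀).μ 𝓕 ≠ ⊤ ∧
      ∀ [IsFiniteMeasure (((haarDatum (genLevel L) (isCompact_genLevel L) (isOpen_genLevel L) S₀).μ).restrict 𝓕)]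
        (hk : Measurable (Function.uncurry (thetaFn D GU φ))) {Ck : ℝ} (hCk : 0 ≤ Ck)
        (hkC : ∀ q u, ‖thetaFn D GU φ q u‖ ≤ Ck),
        PeterssonFubini.theta GU.μ
          (((haarDatum (genLevel L) (isCompact_genLevel L) (isOpen_genLevel L) S₀).μ).restrict 𝓕) hk
          (measurable_coe_char (genLevel L) (isOpen_genLevel L) χ hχT' hlocχ) hCk hkC (norm_coe_char_le χ) ≠ 0 := by
  have hr0 : ∀ i ∈ S, IsSplitPlace L i → 0 < radius L S hνc hχT' hlocχ x₀ hx₀ i :=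
    fun i hi hs => (radius_spec L S hνc hχT' hlocχ x₀ hx₀ i hi hs).1
  have hK₂ : ∀ k ∈ RestrictedProduct.boxSubgroup (genLevel L) (S ∪ T'),
      rep (admissible L hν hχT') k (phi L S x₀ (radius L S hνc hχT' hlocχ x₀ hx₀)) =
        phi L S x₀ (radius L S hνc hχT' hlocχ x₀ hx₀) :=
    fun k hk => rep_phi_eq_self L S x₀ _ hν hχT' hk
  have hM₂ : ∀ S' : Finset (Place (maximalRealSubfield L)), S ∪ T' ⊆ S' →
      ∀ y : (i : ↥S') → locTorus (maximalRealSubfield L) L i,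
        inner ℂ (phi L S x₀ (radius L S hνc hχT' hlocχ x₀ hx₀))
            (rep (admissible L hν hχT') (extendOne (genLevel L) S' y)
              (phi L S x₀ (radius L S hνc hχT' hlocχ x₀ hx₀))) =
          ∏ i : ↥S', localCoeff (genLevel L) (rep (admissible L hν hχT'))
            (phi L S x₀ (radius L S hνc hχT' hlocχ x₀ hx₀)) i (y i) :=
    fun S' _ y => inner_phi_rep_extendOne L S x₀ hν hχT' hr0 S' y
  exact exists_compactDomain_thetaLift_ne_zero_genuine_of_coeffMatch L S₀ hW hh D GU j hj χ hχΓ hχVΓ P hloc hχT'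
    hlocχ (rep (admissible L hν hχT')) (phi L S x₀ (radius L S hνc hχT' hlocχ x₀ hx₀)) (norm_phi L S x₀ hr0)
    hK₂ hM₂ (Finset.union_subset subset_rfl hT'S) hT'S hS
    ((thetaInputOfData L S hν hνc hχT' hlocχ x₀ hx₀).toCoeffInput (norm_phi L S x₀ hr0)) φ hcoeff


-- port_pkg: scope closed for this part
end tensor
end HodgeCM.PerL34.RestrictedTensor.Genuine
end
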